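import Mathlib
import HarnessLib
import Literature.Probability.LatticeModels.LatticeGraph

/-!
# BalabanIR engine `BirComplexStableXY` (stmt-HubbardSuperconductivity-2080): the typed window
action — continuity, periodicity, rotation invariance, slice observable

Support lemmas for crux 2 of route BalabanIR (`--supports stmt-HubbardSuperconductivity-2080`),
typed part of the fixed-volume Laplace analysis.  The local generating function `F`, the window
shift `sh` and the slice observable `O` of `Theses.BalabanIR.BirComplexStableXY` are passed as
functions together with their defining equations (`hF`, `hsh`, `hO`, verbatim the `let`s of the
route statement), so that the final file can instantiate them by `rfl`.  Proved here:

* `birAct_F_eq_sum`, `birAct_continuous_F`: `F` is a finite sum of exponentials of real linear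
  forms, continuous in the window configuration;
* `birAct_F_periodic` / `birAct_action_periodic`: `2π`-periodicity in every angle;
* `birAct_F_rotate` / `birAct_action_rotate`: invariance under the global rotation
  `θ ↦ θ + α` (hypothesis (U1) of the item);
* `birAct_O_*`: the slice observable `O θ = |Σ_x e^{iθ(x,0)}|² / L⁴` is continuous, periodic,
  rotation invariant, bounded by `1`, and equals `1` at the aligned configuration.

No definitions.
-/

namespace Summit.HubbardSuperconductivity.HubbardSuperconductivity.Theorems

open scoped BigOperators
open MeasureTheory Set Complex Literature.Probability.LatticeModels

section Action

variable {r : ℕ} {L M : ℕ}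

/-- `F` unfolded as a sum over the support of the Fourier table. -/
theorem birAct_F_eq_sum (c : ((Fin r × Fin r × Fin r) → ℤ) →₀ ℂ)
    {F : ((Fin r × Fin r × Fin r) → ℝ) → ℂ}
    (hF : ∀ φ, F φ = c.sum (fun n a => a * cexp (I * ((∑ w, (n w : ℝ) * φ w : ℝ) : ℂ))))
    (φ : (Fin r × Fin r × Fin r) → ℝ) :
    F φ = ∑ n ∈ c.support, c n * cexp (I * ((∑ w, (n w : ℝ) * φ w : ℝ) : ℂ)) := by
  rw [hF]; rfl

/-- `F` is continuous in the window configuration. -/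
theorem birAct_continuous_F (c : ((Fin r × Fin r × Fin r) → ℤ) →₀ ℂ)
    {F : ((Fin r × Fin r × Fin r) → ℝ) → ℂ}
    (hF : ∀ φ, F φ = c.sum (fun n a => a * cexp (I * ((∑ w, (n w : ℝ) * φ w : ℝ) : ℂ)))) :
    Continuous F := by
  have : F = fun φ => ∑ n ∈ c.support, c n * cexp (I * ((∑ w, (n w : ℝ) * φ w : ℝ) : ℂ)) :=
    funext (birAct_F_eq_sum c hF)
  rw [this]
  fun_prop

/-- `F` is `2π`-periodic in every window angle. -/
theorem birAct_F_periodic (c : ((Fin r × Fin r × Fin r) → ℤ) →₀ ℂ)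
    {F : ((Fin r × Fin r × Fin r) → ℝ) → ℂ}
    (hF : ∀ φ, F φ = c.sum (fun n a => a * cexp (I * ((∑ w, (n w : ℝ) * φ w : ℝ) : ℂ))))
    (φ : (Fin r × Fin r × Fin r) → ℝ) (m : (Fin r × Fin r × Fin r) → ℤ) :
    F (fun w => φ w + m w • (2 * Real.pi)) = F φ := by
  rw [birAct_F_eq_sum c hF, birAct_F_eq_sum c hF]
  refine Finset.sum_congr rfl fun n _ => ?_
  congr 1
  have hsum : (∑ w, (n w : ℝ) * (φ w + m w • (2 * Real.pi)))
      = (∑ w, (n w : ℝ) * φ w) + ((∑ w, n w * m w : ℤ) : ℝ) * (2 * Real.pi) := by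
    push_cast
    simp only [zsmul_eq_mul, mul_add, Finset.sum_add_distrib, Finset.sum_mul]
    congr 1
    refine Finset.sum_congr rfl fun w _ => ?_
    ring
  rw [hsum]
  push_cast
  rw [mul_add, Complex.exp_add]
  have : cexp (I * ((∑ w, (n w : ℂ) * (m w : ℂ)) * (2 * Real.pi))) = 1 := by
    have h := Complex.exp_int_mul_two_pi_mul_I (∑ w, n w * m w)
    push_cast at h
    rw [← h]
    congr 1
    ring
  rw [this, mul_one]

/-- Under (U1) (`Σ_w n_w = 0` on the support), `F` is invariant under a global rotation. -/
theorem birAct_F_rotate (c : ((Fin r × Fin r × Fin r) → ℤ) →₀ ℂ)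
    (hU1 : ∀ n ∈ c.support, ∑ w, n w = 0)
    {F : ((Fin r × Fin r × Fin r) → ℝ) → ℂ}
    (hF : ∀ φ, F φ = c.sum (fun n a => a * cexp (I * ((∑ w, (n w : ℝ) * φ w : ℝ) : ℂ))))
    (φ : (Fin r × Fin r × Fin r) → ℝ) (α : ℝ) :
    F (fun w => φ w + α) = F φ := by
  rw [birAct_F_eq_sum c hF, birAct_F_eq_sum c hF]
  refine Finset.sum_congr rfl fun n hn => ?_
  congr 3
  have h0 : ((∑ w, n w : ℤ) : ℝ) = 0 := by rw [hU1 n hn]; simp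
  have : (∑ w, (n w : ℝ) * (φ w + α)) = (∑ w, (n w : ℝ) * φ w) + ((∑ w, n w : ℤ) : ℝ) * α := by
    push_cast
    simp only [mul_add, Finset.sum_add_distrib, Finset.sum_mul]
  rw [this, h0, zero_mul, add_zero]

variable [NeZero L] [NeZero M]

/-- The summed window action `θ ↦ Σ_s F (θ ∘ sh s)` is continuous. -/
theorem birAct_continuous_action (c : ((Fin r × Fin r × Fin r) → ℤ) →₀ ℂ)
    {F : ((Fin r × Fin r × Fin r) → ℝ) → ℂ}
    (hF : ∀ φ, F φ = c.sum (fun n a => a * cexp (I * ((∑ w, (n w : ℝ) * φ w : ℝ) : ℂ))))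
    (sh : (TorusSite 2 L × ZMod M) → (Fin r × Fin r × Fin r) → (TorusSite 2 L × ZMod M)) :
    Continuous fun θ : (TorusSite 2 L × ZMod M) → ℝ => ∑ s, F (fun w => θ (sh s w)) := by
  have hFc := birAct_continuous_F c hF
  refine continuous_finsetSum _ fun s _ => hFc.comp ?_
  exact continuous_pi fun w => continuous_apply _

/-- The summed window action is `2π`-periodic in every angle. -/
theorem birAct_action_periodic (c : ((Fin r × Fin r × Fin r) → ℤ) →₀ ℂ)
    {F : ((Fin r × Fin r × Fin r) → ℝ) → ℂ}
    (hF : ∀ φ, F φ = c.sum (fun n a => a * cexp (I * ((∑ w, (n w : ℝ) * φ w : ℝ) : ℂ))))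
    (sh : (TorusSite 2 L × ZMod M) → (Fin r × Fin r × Fin r) → (TorusSite 2 L × ZMod M))
    (θ : (TorusSite 2 L × ZMod M) → ℝ) (k : (TorusSite 2 L × ZMod M) → ℤ) :
    (∑ s, F (fun w => (fun i => θ i + k i • (2 * Real.pi)) (sh s w)))
      = ∑ s, F (fun w => θ (sh s w)) := by
  refine Finset.sum_congr rfl fun s _ => ?_
  exact birAct_F_periodic c hF (fun w => θ (sh s w)) (fun w => k (sh s w))

/-- Under (U1) the summed window action is invariant under the global rotation `θ ↦ θ + α`. -/
theorem birAct_action_rotate (c : ((Fin r × Fin r × Fin r) → ℤ) →₀ ℂ)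
    (hU1 : ∀ n ∈ c.support, ∑ w, n w = 0)
    {F : ((Fin r × Fin r × Fin r) → ℝ) → ℂ}
    (hF : ∀ φ, F φ = c.sum (fun n a => a * cexp (I * ((∑ w, (n w : ℝ) * φ w : ℝ) : ℂ))))
    (sh : (TorusSite 2 L × ZMod M) → (Fin r × Fin r × Fin r) → (TorusSite 2 L × ZMod M))
    (θ : (TorusSite 2 L × ZMod M) → ℝ) (α : ℝ) :
    (∑ s, F (fun w => (fun i => θ i + α) (sh s w))) = ∑ s, F (fun w => θ (sh s w)) := by
  refine Finset.sum_congr rfl fun s _ => ?_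
  exact birAct_F_rotate c hU1 hF (fun w => θ (sh s w)) α

end Action

section Observable

variable {L M : ℕ} [NeZero L]

/-! ### The slice observable -/

/-- The slice observable is continuous. -/
theorem birAct_O_continuous {O : ((TorusSite 2 L × ZMod M) → ℝ) → ℝ}
    (hO : ∀ θ, O θ = ‖∑ x : TorusSite 2 L, cexp (I * (θ (x, 0) : ℂ))‖ ^ 2 / (L : ℝ) ^ 4) :
    Continuous O := by
  have : O = fun θ => ‖∑ x : TorusSite 2 L, cexp (I * (θ (x, 0) : ℂ))‖ ^ 2 / (L : ℝ) ^ 4 :=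
    funext hO
  rw [this]
  fun_prop

/-- The slice observable is `2π`-periodic in every angle. -/
theorem birAct_O_periodic {O : ((TorusSite 2 L × ZMod M) → ℝ) → ℝ}
    (hO : ∀ θ, O θ = ‖∑ x : TorusSite 2 L, cexp (I * (θ (x, 0) : ℂ))‖ ^ 2 / (L : ℝ) ^ 4)
    (θ : (TorusSite 2 L × ZMod M) → ℝ) (k : (TorusSite 2 L × ZMod M) → ℤ) :
    O (fun i => θ i + k i • (2 * Real.pi)) = O θ := by
  rw [hO, hO]
  congr 3
  refine Finset.sum_congr rfl fun x _ => ?_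
  push_cast
  rw [mul_add, Complex.exp_add]
  have : cexp (I * ((k (x, 0) : ℂ) * (2 * Real.pi))) = 1 := by
    have h := Complex.exp_int_mul_two_pi_mul_I (k (x, 0))
    rw [← h]; congr 1; ring
  rw [zsmul_eq_mul]
  rw [this, mul_one]

/-- The slice observable is invariant under the global rotation. -/
theorem birAct_O_rotate {O : ((TorusSite 2 L × ZMod M) → ℝ) → ℝ}
    (hO : ∀ θ, O θ = ‖∑ x : TorusSite 2 L, cexp (I * (θ (x, 0) : ℂ))‖ ^ 2 / (L : ℝ) ^ 4)
    (θ : (TorusSite 2 L × ZMod M) → ℝ) (α : ℝ) :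
    O (fun i => θ i + α) = O θ := by
  rw [hO, hO]
  congr 2
  have : (∑ x : TorusSite 2 L, cexp (I * ((θ (x, 0) + α : ℝ) : ℂ)))
      = cexp (I * α) * ∑ x : TorusSite 2 L, cexp (I * (θ (x, 0) : ℂ)) := by
    rw [Finset.mul_sum]
    refine Finset.sum_congr rfl fun x _ => ?_
    rw [← Complex.exp_add]; congr 1; push_cast; ring
  rw [this, norm_mul]
  have hn : ‖cexp (I * (α : ℂ))‖ = 1 := by
    rw [mul_comm, Complex.norm_exp_ofReal_mul_I]
  rw [hn, one_mul]

end Observable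

section Forms

variable {r : ℕ} {L M : ℕ} [NeZero L] [NeZero M]

/-- Extension by zero recovered from the subtype sum: `Σ_j [i = j] δ_j = ext δ i`. -/
theorem birAct_sum_ite_mul_eq_ext (s₀ : TorusSite 2 L × ZMod M) (δ : {i // i ≠ s₀} → ℝ)
    (i : TorusSite 2 L × ZMod M) :
    (∑ j : {i // i ≠ s₀}, (if i = j.1 then (1 : ℝ) else 0) * δ j)
      = (if h : i = s₀ then (0 : ℝ) else δ ⟨i, h⟩) := by
  by_cases h : i = s₀
  · rw [dif_pos h]
    refine Finset.sum_eq_zero fun j _ => ?_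
    have hne : ¬ i = j.1 := fun hij => j.2 (hij.symm.trans h)
    rw [if_neg hne, zero_mul]
  · rw [dif_neg h, Finset.sum_eq_single ⟨i, h⟩]
    · simp
    · intro j _ hj
      have hne : ¬ i = j.1 := by
        intro hij
        apply hj
        exact Subtype.ext hij.symm
      rw [if_neg hne, zero_mul]
    · intro hi; exact absurd (Finset.mem_univ _) hi

/-- The real linear form attached to a window translate:
`Σ_j a_{(s,n)}(j) δ_j = Σ_w n_w (ext δ)(sh s w)`. -/
theorem birAct_form_eq (s₀ : TorusSite 2 L × ZMod M) (δ : {i // i ≠ s₀} → ℝ)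
    (sh : (TorusSite 2 L × ZMod M) → (Fin r × Fin r × Fin r) → (TorusSite 2 L × ZMod M))
    (s : TorusSite 2 L × ZMod M) (n : (Fin r × Fin r × Fin r) → ℤ) :
    (∑ j : {i // i ≠ s₀}, (∑ w, (n w : ℝ) * (if sh s w = j.1 then (1 : ℝ) else 0)) * δ j)
      = ∑ w, (n w : ℝ) * (fun i => if h : i = s₀ then (0 : ℝ) else δ ⟨i, h⟩) (sh s w) := by
  simp_rw [Finset.sum_mul]
  rw [Finset.sum_comm]
  refine Finset.sum_congr rfl fun w _ => ?_
  simp_rw [mul_assoc]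
  rw [← Finset.mul_sum, birAct_sum_ite_mul_eq_ext s₀ δ (sh s w)]

/-- After fixing the spin at `s₀`, the summed window action is a sum, over window translates
and Fourier modes, of exponentials of real linear forms in the remaining angles. -/
theorem birAct_action_eq_sum_forms (c : ((Fin r × Fin r × Fin r) → ℤ) →₀ ℂ)
    {F : ((Fin r × Fin r × Fin r) → ℝ) → ℂ}
    (hF : ∀ φ, F φ = c.sum (fun n a => a * cexp (I * ((∑ w, (n w : ℝ) * φ w : ℝ) : ℂ))))
    (sh : (TorusSite 2 L × ZMod M) → (Fin r × Fin r × Fin r) → (TorusSite 2 L × ZMod M))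
    (s₀ : TorusSite 2 L × ZMod M) (δ : {i // i ≠ s₀} → ℝ) :
    (∑ s, F (fun w => (fun i => if h : i = s₀ then (0 : ℝ) else δ ⟨i, h⟩) (sh s w)))
      = ∑ k : (TorusSite 2 L × ZMod M) × ↥c.support, c k.2 *
          cexp (I * ((∑ j : {i // i ≠ s₀}, (∑ w, ((k.2 : (Fin r × Fin r × Fin r) → ℤ) w : ℝ) *
            (if sh k.1 w = j.1 then (1 : ℝ) else 0)) * δ j : ℝ) : ℂ)) := by
  conv_rhs => rw [Fintype.sum_prod_type]
  refine Fintype.sum_congr _ _ fun s => ?_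
  rw [birAct_F_eq_sum c hF, ← Finset.sum_coe_sort]
  refine Fintype.sum_congr _ _ fun n => ?_
  dsimp only
  rw [birAct_form_eq s₀ δ sh s]

/-- Hypothesis (N) makes the weights sum to zero. -/
theorem birAct_weights_sum_eq_zero (c : ((Fin r × Fin r × Fin r) → ℤ) →₀ ℂ)
    (hN : c.sum (fun _ a => a) = 0) :
    (∑ k : (TorusSite 2 L × ZMod M) × ↥c.support, c k.2) = 0 := by
  have hN' : ∑ n ∈ c.support, c n = 0 := hN
  rw [Fintype.sum_prod_type]
  refine Finset.sum_eq_zero fun s _ => ?_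
  dsimp only
  rw [Finset.sum_coe_sort c.support (fun n => c n)]
  exact hN'

omit [NeZero L] [NeZero M] in
/-- The window shift is the translation by a fixed vector. -/
theorem birAct_sh_eq_add
    {sh : (TorusSite 2 L × ZMod M) → (Fin r × Fin r × Fin r) → (TorusSite 2 L × ZMod M)}
    (hsh : ∀ s w, sh s w = (s.1 + ![((w.1 : ℕ) : ZMod L), ((w.2.1 : ℕ) : ZMod L)],
      s.2 + ((w.2.2 : ℕ) : ZMod M)))
    (s : TorusSite 2 L × ZMod M) (w : Fin r × Fin r × Fin r) :
    sh s w = s + (![((w.1 : ℕ) : ZMod L), ((w.2.1 : ℕ) : ZMod L)], ((w.2.2 : ℕ) : ZMod M)) := by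
  rw [hsh]; rfl

/-- Hypothesis (U1) makes the weighted sum of the linear forms vanish identically (the linear
term of the expansion around the aligned configuration cancels). -/
theorem birAct_weighted_forms_eq_zero (c : ((Fin r × Fin r × Fin r) → ℤ) →₀ ℂ)
    (hU1 : ∀ n ∈ c.support, ∑ w, n w = 0)
    {sh : (TorusSite 2 L × ZMod M) → (Fin r × Fin r × Fin r) → (TorusSite 2 L × ZMod M)}
    (hsh : ∀ s w, sh s w = (s.1 + ![((w.1 : ℕ) : ZMod L), ((w.2.1 : ℕ) : ZMod L)],
      s.2 + ((w.2.2 : ℕ) : ZMod M)))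
    (s₀ : TorusSite 2 L × ZMod M) (δ : {i // i ≠ s₀} → ℝ) :
    (∑ k : (TorusSite 2 L × ZMod M) × ↥c.support, c k.2 *
        ((∑ j : {i // i ≠ s₀}, (∑ w, ((k.2 : (Fin r × Fin r × Fin r) → ℤ) w : ℝ) *
          (if sh k.1 w = j.1 then (1 : ℝ) else 0)) * δ j : ℝ) : ℂ)) = 0 := by
  set ext : (TorusSite 2 L × ZMod M) → ℝ := fun i => if h : i = s₀ then (0 : ℝ) else δ ⟨i, h⟩
    with hext
  set T : ℝ := ∑ i, ext i with hT
  -- translates of the full-lattice sum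
  have htrans : ∀ w : Fin r × Fin r × Fin r, (∑ s, ext (sh s w)) = T := by
    intro w
    simp_rw [birAct_sh_eq_add hsh]
    exact Equiv.sum_comp (Equiv.addRight _) ext
  have hk : ∀ k : (TorusSite 2 L × ZMod M) × ↥c.support,
      (∑ j : {i // i ≠ s₀}, (∑ w, ((k.2 : (Fin r × Fin r × Fin r) → ℤ) w : ℝ) *
          (if sh k.1 w = j.1 then (1 : ℝ) else 0)) * δ j)
        = ∑ w, ((k.2 : (Fin r × Fin r × Fin r) → ℤ) w : ℝ) * ext (sh k.1 w) :=
    fun k => birAct_form_eq s₀ δ sh k.1 k.2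
  simp_rw [hk]
  rw [Fintype.sum_prod_type, Finset.sum_comm]
  refine Finset.sum_eq_zero fun n _ => ?_
  dsimp only
  rw [← Finset.mul_sum]
  have hinner : (∑ s, ((∑ w, ((n : (Fin r × Fin r × Fin r) → ℤ) w : ℝ) * ext (sh s w) : ℝ) : ℂ))
      = 0 := by
    rw [← Complex.ofReal_sum, Finset.sum_comm]
    simp_rw [← Finset.mul_sum, htrans]
    rw [← Finset.sum_mul]
    have h0 : (∑ w, ((n : (Fin r × Fin r × Fin r) → ℤ) w : ℝ)) = 0 := by
      have := hU1 n.1 n.2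
      exact_mod_cast this
    rw [h0, zero_mul, Complex.ofReal_zero]
  rw [hinner, mul_zero]

end Forms

end Summit.HubbardSuperconductivity.HubbardSuperconductivity.Theorems
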